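import Literature.IUT.HodgeTheaters.BaseBridgeModels
import HarnessLib

/-!
# Base-NF-bridges, base-Θ-bridges, base-ΘNF-Hodge theaters ([IUTchI] Definition 4.6, Propositions 4.7–4.9,
# Remarks 4.7.1–4.7.2, 4.9.1–4.9.3) — abc-iut cell, layer L5, statements-first

Mochizuki, *Inter-universal Teichmüller theory I*, §4 (kurims May-2020 manuscript), pp. 111–119, typed over
the hypothesis structure `BaseThetaDatum` and the model bridges of `BaseBridgeModels.lean`.

* Definition 4.6 (i)–(iii) p. 111–112: `𝒟`-NF-bridges `†φ^NF_⋇ : †𝒟_J → †𝒟^⊚` (`DNFBridge`), `𝒟`-Θ-bridges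
  `†φ^Θ_⋇ : †𝒟_J → †𝒟_>` (`DThetaBridge`), `𝒟`-ΘNF-Hodge theaters `†𝒟^⊚ ← †𝒟_J → †𝒟_>` (`DThetaNFHodgeTheater`),
  each "such that there exist isomorphisms [from the models] conjugation by which maps `φ_⋇ ↦ †φ_⋇`", and
  their (iso)morphisms (`DNFBridge.Hom`, `DThetaBridge.Hom`, `DThetaNFHodgeTheater.Hom`).
* Proposition 4.7 (i)–(iii) p. 112–113: the bijection `†χ : J ⥲ F_l^⋇` determined by the evaluation-section
  structure at `v ∈ 𝕍^bad` (`DThetaBridge.χ`, with its INTRINSIC characterisation `DThetaBridge.χ_spec`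
  PROVED: `†φ^Θ_j` at a bad `v` consists of evaluation-section morphisms of label `†χ(j)`); (ii) the isomorphisms
  of torsors `†φ^LC_j` and (iii) the element `[†ε]`, the bijection `†ζ_⋆ : LabCusp(†𝒟^⊚) ⥲ J` and its
  independence of the choice of `†φ^NF_⋆` in its `F_l^⋇`-orbit, as named Prop-valued statements over a
  `𝒟`-ΘNF-Hodge theater (`Prop47ii`, `Prop47iii`) — their model case is PROVED in `BaseBridgeModels.lean`
  (`labPull_of_mem_phiNFj`, `labEquiv_phiLC_εLab`, `εLab_unique`).
* Proposition 4.8 (i)–(iv) p. 115 ("First properties"): (ii) "the set of isomorphisms between two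
  `𝒟`-Θ-bridges is of cardinality one" is PROVED (`DThetaBridge.Hom.subsingleton`, `DThetaBridge.Hom.nonempty`);
  (i), (iii), (iv) and the Hodge-theater half of (ii) are named Prop-valued statements (`Prop48i`, `Prop48iiHT`,
  `Prop48iii`, `Prop48iv`).
* Proposition 4.9 (i)–(iii) p. 115–116: the forgetful operations (`DThetaNFHodgeTheater.toDNFBridge`,
  `.toMonoCapsule`) and the symmetries: `F_l^⋇` acts simply transitively on `J` (PROVED: `Prop49i`), `𝔖_{l^⋇}`
  transitively (PROVED: `Prop49ii`); the count "precisely `l^⋇` possibilities" is `card_labelings` (`Processions.lean`).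
* Remarks 4.7.1, 4.7.2 (i)–(iii), 4.9.1 (i)–(ii), 4.9.2 (ii),(iv),(v), 4.9.3 (i)–(ii) are EXPOSITORY (global
  `LabCusp(†𝒟^⊚)` immune to the "collapsing" of Rem. 4.2.1; Fig. 4.4, Frobenius-like `†𝒟_>` vs étale-like `†𝒟^⊚`;
  `(†ζ_⋆)⁻¹` as a "combinatorial Kodaira–Spencer morphism"; comparison of log-volumes across labels; cyclic vs full
  symmetry; synchronized vs nonsynchronized indeterminacies; the summary (a)–(d); why `X→_v` rather than `C_v`)
  and are recorded by this sentence; Rem. 4.9.2 (i) is `DThetaBridge.χ` being a bijection, Rem. 4.9.2 (iii) is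
  `indepIndeterminacy_eq` (`Processions.lean`).

Record-only; [claim: Mochizuki2012, status: disputed]; nothing here takes a side.
-/

namespace Literature.IUT.HodgeTheaters

open CategoryTheory

universe u

namespace BaseThetaDatum

variable (𝔡 : BaseThetaDatum.{u})

/-! ### Definition 4.6 (i): `𝒟`-NF-bridges -/

/-- Transport of a poly-morphism `𝒟_v → 𝒟^⊚` of the model to isomorphs: `{δ ∘ f ∘ κ⁻¹ | f ∈ P}`.
[claim: Mochizuki2012, status: disputed] -/
def PolyHomNF.conj {v : 𝔡.V} {X : 𝔡.Amb v} {Y : 𝔡.AmbG} (κ : 𝔡.D v ≅ X) (δ : 𝔡.DG ≅ Y)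
    (P : PolyHomNF v (𝔡.D v) 𝔡.DG) : PolyHomNF v X Y :=
  {g | ∃ f ∈ P, g = 𝔡.postNF (𝔡.preNF κ.symm f) δ}

/-- **Definition 4.6 (i)** ([IUTchI] p. 111): a *base-NF-bridge*, or *`𝒟`-NF-bridge*, is a poly-morphism
`†φ^NF_⋇ : †𝒟_J → †𝒟^⊚` from a capsule of `𝒟`-prime-strips indexed by a finite set `J` to an isomorph `†𝒟^⊚` of
`𝒟^⊚` "such that there exist isomorphisms `𝒟^⊚ ⥲ †𝒟^⊚`, `𝒟_⋇ ⥲ †𝒟_J`, conjugation by which maps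
`φ^NF_⋇ ↦ †φ^NF_⋇`". [claim: Mochizuki2012, status: disputed] -/
structure DNFBridge where
  /-- the finite index set `J` -/
  J : Type
  /-- the capsule `†𝒟_J` -/
  capsule : 𝔡.DCapsule J
  /-- the global object `†𝒟^⊚` -/
  glob : 𝔡.AmbG
  /-- the poly-morphism `†φ^NF_⋇ = {†φ^NF_j}_{j∈J}` -/
  poly : DCapsule.PolyHomNF capsule glob
  /-- isomorphic to the model `φ^NF_⋇` of Example 4.3 (iv) -/
  isModel : ∃ (ι : FlStar 𝔡.l ≃ J) (κ : ∀ j, 𝔡.tautStrip ≅ capsule (ι j)) (δ : 𝔡.DG ≅ glob),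
    ∀ j v, poly (ι j) v = PolyHomNF.conj 𝔡 (Pi.isoApp (κ j) v) δ (𝔡.phiNFj j v)

/-- **Definition 4.6 (i), morphisms**: an (iso)morphism of `𝒟`-NF-bridges is a pair consisting of "a
capsule-full poly-isomorphism `†𝒟_J ⥲ ‡𝒟_{J'}`" (determined by a bijection of index sets) and "a poly-morphism
`†𝒟^⊚ → ‡𝒟^⊚` which is an `Aut_ε(†𝒟^⊚)`-orbit of isomorphisms", "compatible with `†φ^NF_⋇`, `‡φ^NF_⋇`":
for each `j`, `v`, post-composing `†φ^NF_{j,v}` with the orbit equals pre-composing `‡φ^NF_{ι(j),v}` with the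
full poly-isomorphism. [claim: Mochizuki2012, status: disputed] -/
structure DNFBridge.Hom (B B' : 𝔡.DNFBridge) where
  /-- the bijection of index sets underlying the capsule-full poly-isomorphism -/
  ι : B.J ≃ B'.J
  /-- the `Aut_ε`-orbit of isomorphisms `†𝒟^⊚ ⥲ ‡𝒟^⊚` -/
  orbit : Set (B.glob ≅ B'.glob)
  /-- it is one `Aut_ε(†𝒟^⊚)`-orbit -/
  isOrbit : ∃ δ : B.glob ≅ B'.glob, orbit = {δ' | ∃ β : B.glob ≅ B.glob, autLabel β = 1 ∧ δ' = β ≪≫ δ}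
  /-- compatibility with the bridges -/
  comm : ∀ j v, (B.poly j v).post orbit =
    {g | ∃ (κ : B.capsule j v ≅ B'.capsule (ι j) v), ∃ f ∈ B'.poly (ι j) v, g = 𝔡.preNF κ f}

/-! ### Definition 4.6 (ii): `𝒟`-Θ-bridges -/

/-- **Definition 4.6 (ii)** ([IUTchI] p. 111): a *base-Θ-bridge*, or *`𝒟`-Θ-bridge*, is a poly-morphism
`†φ^Θ_⋇ : †𝒟_J → †𝒟_>` from a capsule of `𝒟`-prime-strips indexed by a finite set `J` to a `𝒟`-prime-strip
`†𝒟_>` "such that there exist isomorphisms `𝒟_> ⥲ †𝒟_>`, `𝒟_⋇ ⥲ †𝒟_J`, conjugation by which maps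
`φ^Θ_⋇ ↦ †φ^Θ_⋇`". [claim: Mochizuki2012, status: disputed] -/
structure DThetaBridge where
  /-- the finite index set `J` -/
  J : Type
  /-- the capsule `†𝒟_J` -/
  capsule : 𝔡.DCapsule J
  /-- the codomain `†𝒟_>` -/
  cod : 𝔡.DPrimeStrip
  /-- the poly-morphism `†φ^Θ_⋇ = {†φ^Θ_j}_{j∈J}` -/
  poly : DCapsule.PolyHom capsule cod
  /-- isomorphic to the model `φ^Θ_⋇` of Example 4.4 (iv) -/
  isModel : ∃ (ι : FlStar 𝔡.l ≃ J) (κ : ∀ j, 𝔡.tautStrip ≅ capsule (ι j)) (γ : 𝔡.tautStrip ≅ cod),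
    ∀ j v, poly (ι j) v =
      {g | ∃ f ∈ 𝔡.modelThetaBridge j v, g = (Pi.isoApp (κ j) v).inv ≫ f ≫ (Pi.isoApp γ v).hom}

/-- **Definition 4.6 (ii), morphisms**: an (iso)morphism of `𝒟`-Θ-bridges is a pair consisting of "a
capsule-full poly-isomorphism `†𝒟_J ⥲ ‡𝒟_{J'}`" (determined by a bijection `ι`) and "the full poly-isomorphism
`†𝒟_> ⥲ ‡𝒟_>`" (no further datum), "compatible with `†φ^Θ_⋆`, `‡φ^Θ_⋆`".
[claim: Mochizuki2012, status: disputed] -/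
structure DThetaBridge.Hom (B B' : 𝔡.DThetaBridge) where
  /-- the bijection of index sets -/
  ι : B.J ≃ B'.J
  /-- compatibility: `(full) ∘ †φ^Θ_j = ‡φ^Θ_{ι j} ∘ (full)` as poly-morphisms `†𝒟_j → ‡𝒟_>`, place by place -/
  comm : ∀ j v, {g : B.capsule j v ⟶ B'.cod v | ∃ f ∈ B.poly j v, ∃ γ : B.cod v ≅ B'.cod v, g = f ≫ γ.hom} =
    {g | ∃ (κ : B.capsule j v ≅ B'.capsule (ι j) v), ∃ f ∈ B'.poly (ι j) v, g = κ.hom ≫ f}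

/-! ### Definition 4.6 (iii): `𝒟`-ΘNF-Hodge theaters -/

/-- **Definition 4.6 (iii)** ([IUTchI] p. 112): a *base-ΘNF-Hodge theater*, or *`𝒟`-ΘNF-Hodge theater*,
`†ℋ𝒯^{𝒟-ΘNF} = (†𝒟^⊚ ⟵ †𝒟_J ⟶ †𝒟_>)`: a `𝒟`-NF-bridge and a `𝒟`-Θ-bridge with the SAME capsule "such that
there exist isomorphisms `𝒟^⊚ ⥲ †𝒟^⊚`; `𝒟_⋆ ⥲ †𝒟_J`; `𝒟_> ⥲ †𝒟_>` conjugation by which maps `φ^NF_⋆ ↦ †φ^NF_⋆`,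
`φ^Θ_⋆ ↦ †φ^Θ_⋆`" (one capsule isomorphism serving both). [claim: Mochizuki2012, status: disputed] -/
structure DThetaNFHodgeTheater where
  /-- the finite index set `J` -/
  J : Type
  /-- the capsule `†𝒟_J` -/
  capsule : 𝔡.DCapsule J
  /-- `†𝒟^⊚` -/
  glob : 𝔡.AmbG
  /-- `†𝒟_>` -/
  cod : 𝔡.DPrimeStrip
  /-- `†φ^NF_⋆` -/
  polyNF : DCapsule.PolyHomNF capsule glob
  /-- `†φ^Θ_⋆` -/
  polyΘ : DCapsule.PolyHom capsule cod
  /-- simultaneously isomorphic to the models -/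
  isModel : ∃ (ι : FlStar 𝔡.l ≃ J) (κ : ∀ j, 𝔡.tautStrip ≅ capsule (ι j)) (δ : 𝔡.DG ≅ glob)
      (γ : 𝔡.tautStrip ≅ cod),
    (∀ j v, polyNF (ι j) v = PolyHomNF.conj 𝔡 (Pi.isoApp (κ j) v) δ (𝔡.phiNFj j v)) ∧
    ∀ j v, polyΘ (ι j) v =
      {g | ∃ f ∈ 𝔡.modelThetaBridge j v, g = (Pi.isoApp (κ j) v).inv ≫ f ≫ (Pi.isoApp γ v).hom}

variable {𝔡}

/-- **Proposition 4.9 (i), the forgetful operation** `†ℋ𝒯^{𝒟-ΘNF} ↦ (†𝒟^⊚ ⟵ †𝒟_J)`, the underlying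
`𝒟`-NF-bridge. [claim: Mochizuki2012, status: disputed] -/
def DThetaNFHodgeTheater.toDNFBridge (H : 𝔡.DThetaNFHodgeTheater) : 𝔡.DNFBridge where
  J := H.J
  capsule := H.capsule
  glob := H.glob
  poly := H.polyNF
  isModel := let ⟨ι, κ, δ, _, h, _⟩ := H.isModel; ⟨ι, κ, δ, h⟩

/-- The underlying `𝒟`-Θ-bridge of a `𝒟`-ΘNF-Hodge theater. [claim: Mochizuki2012, status: disputed] -/
def DThetaNFHodgeTheater.toDThetaBridge (H : 𝔡.DThetaNFHodgeTheater) : 𝔡.DThetaBridge where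
  J := H.J
  capsule := H.capsule
  cod := H.cod
  poly := H.polyΘ
  isModel := let ⟨ι, κ, _, γ, _, h⟩ := H.isModel; ⟨ι, κ, γ, h⟩

/-- **Definition 4.6 (iii), morphisms**: "a pair of morphisms between the respective associated `𝒟`-NF- and
`𝒟`-Θ-bridges that are compatible with one another in the sense that they induce the same bijection between
the index sets". [claim: Mochizuki2012, status: disputed] -/
structure DThetaNFHodgeTheater.Hom (H H' : 𝔡.DThetaNFHodgeTheater) where
  /-- the morphism of underlying `𝒟`-NF-bridges -/
  nf : DNFBridge.Hom 𝔡 H.toDNFBridge H'.toDNFBridge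
  /-- the morphism of underlying `𝒟`-Θ-bridges -/
  theta : DThetaBridge.Hom 𝔡 H.toDThetaBridge H'.toDThetaBridge
  /-- same bijection of index sets -/
  compat : nf.ι = theta.ι

/-! ### Proposition 4.7 (i): labels from a `𝒟`-Θ-bridge -/

/-- A `𝒟`-Θ-bridge's constituent poly-morphisms are the model ones between isomorphs: `†φ^Θ_{ι(j),v}` is
`φ^Θ_{v_j}` from `†𝒟_{ι(j),v}` to `†𝒟_{>,v}` (iso-saturation of the model poly-morphisms).
[claim: Mochizuki2012, status: disputed] -/
theorem DThetaBridge.poly_eq_phiThetaAt (B : 𝔡.DThetaBridge) :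
    ∃ ι : FlStar 𝔡.l ≃ B.J, ∀ j v, B.poly (ι j) v = 𝔡.phiThetaAt j v (B.capsule (ι j) v) (B.cod v) := by
  obtain ⟨ι, κ, γ, h⟩ := B.isModel
  refine ⟨ι, fun j v => ?_⟩
  rw [h j v]
  ext g
  constructor
  · rintro ⟨f, hf, rfl⟩
    exact phiThetaAt_isoComp j (Pi.isoApp (κ j) v).symm (phiThetaAt_compIso j (Pi.isoApp γ v) hf)
  · intro hg
    refine ⟨(Pi.isoApp (κ j) v).hom ≫ g ≫ (Pi.isoApp γ v).inv, ?_, ?_⟩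
    · exact phiThetaAt_isoComp j (Pi.isoApp (κ j) v) (phiThetaAt_compIso j (Pi.isoApp γ v).symm hg)
    · rw [Category.assoc, Category.assoc, Iso.inv_hom_id, Category.comp_id, Iso.inv_hom_id_assoc]

/-- **Proposition 4.7 (i)** ([IUTchI] p. 112): "the structure at the various `v ∈ 𝕍^bad` of the `𝒟`-Θ-bridge
`†φ^Θ_⋆` [i.e., involving evaluation sections] determines a bijection `†χ : π₀(†𝒟_J) = J ⥲ F_l^⋇` — i.e.,
determines labels `∈ F_l^⋇` for the constituent `𝒟`-prime-strips of the capsule `†𝒟_J`" (Rem. 4.9.2 (i): "this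
correspondence is always bijective"). [claim: Mochizuki2012, status: disputed] -/
noncomputable def DThetaBridge.χ (B : 𝔡.DThetaBridge) : B.J ≃ FlStar 𝔡.l := B.poly_eq_phiThetaAt.choose.symm

/-- "indexed by a finite index set `J`" (Def. 4.6): finiteness of `J` follows from `†χ : J ⥲ F_l^⋇`.
[claim: Mochizuki2012, status: disputed] -/
theorem DThetaBridge.finite_J (B : 𝔡.DThetaBridge) : Finite B.J := Finite.of_equiv _ B.χ.symm

/-- Prop. 4.7 (i), INTRINSIC characterisation of `†χ`: for every `j ∈ J` and every place `v`, the poly-morphism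
`†φ^Θ_{j,v}` is the evaluation-section/full poly-morphism of label `†χ(j)` — in particular (at any `v ∈ 𝕍^bad`,
which exists) `†χ` does not depend on the model isomorphisms used to exhibit it. [claim: Mochizuki2012, status: disputed] -/
theorem DThetaBridge.χ_spec (B : 𝔡.DThetaBridge) (j : B.J) (v : 𝔡.V) :
    B.poly j v = 𝔡.phiThetaAt (B.χ j) v (B.capsule j v) (B.cod v) := by
  have h := B.poly_eq_phiThetaAt.choose_spec (B.χ j) v
  have hj : B.poly_eq_phiThetaAt.choose (B.χ j) = j := Equiv.apply_symm_apply _ j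
  rw [hj] at h
  exact h

/-- Prop. 4.7 (i), uniqueness: a label function compatible with `†φ^Θ_⋆` at one bad place is `†χ`. [claim: Mochizuki2012, status: disputed] -/
theorem DThetaBridge.χ_unique (B : 𝔡.DThetaBridge) {v : 𝔡.V} (hv : 𝔡.IsBad v) (χ' : B.J → FlStar 𝔡.l)
    (h : ∀ j, ∀ f ∈ B.poly j v, f ∈ 𝔡.phiThetaAt (χ' j) v (B.capsule j v) (B.cod v)) : χ' = B.χ := by
  funext j
  obtain ⟨f, hf⟩ := phiThetaAt_nonempty (B.χ j) v (B.capsule j v) (B.cod v)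
  have hf' : f ∈ B.poly j v := by rw [B.χ_spec]; exact hf
  exact phiThetaAt_label_unique hv (h j f hf') hf

/-! ### Proposition 4.8 (ii) for `𝒟`-Θ-bridges: exactly one isomorphism -/

/-- Prop. 4.8 (ii): a morphism of `𝒟`-Θ-bridges respects the labels `†χ`. [claim: Mochizuki2012, status: disputed] -/
theorem DThetaBridge.Hom.χ_comp {B B' : 𝔡.DThetaBridge} (φ : DThetaBridge.Hom 𝔡 B B') (j : B.J) :
    B'.χ (φ.ι j) = B.χ j := by
  obtain ⟨v, hv⟩ := 𝔡.exists_isBad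
  obtain ⟨f, hf⟩ := phiThetaAt_nonempty (B.χ j) v (B.capsule j v) (B.cod v)
  obtain ⟨γ⟩ := 𝔡.nonempty_iso v (B.cod v) (B'.cod v)
  have hmem : f ≫ γ.hom ∈ {g : B.capsule j v ⟶ B'.cod v |
      ∃ f ∈ B.poly j v, ∃ γ : B.cod v ≅ B'.cod v, g = f ≫ γ.hom} :=
    ⟨f, by rw [B.χ_spec]; exact hf, γ, rfl⟩
  rw [φ.comm j v] at hmem
  obtain ⟨κ, f', hf', hff'⟩ := hmem
  rw [B'.χ_spec] at hf'
  have h1 : f ≫ γ.hom ∈ 𝔡.phiThetaAt (B.χ j) v _ _ := phiThetaAt_compIso _ γ hf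
  have h2 : κ.hom ≫ f' ∈ 𝔡.phiThetaAt (B'.χ (φ.ι j)) v (B.capsule j v) (B'.cod v) :=
    phiThetaAt_isoComp _ κ hf'
  rw [hff'] at h1
  exact phiThetaAt_label_unique hv h2 h1

/-- **Proposition 4.8 (ii)** ([IUTchI] p. 115), uniqueness half: between two `𝒟`-Θ-bridges there is AT MOST one
isomorphism. [claim: Mochizuki2012, status: disputed] -/
theorem DThetaBridge.Hom.subsingleton (B B' : 𝔡.DThetaBridge) : Subsingleton (DThetaBridge.Hom 𝔡 B B') := by
  refine ⟨fun φ ψ => ?_⟩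
  have hι : φ.ι = ψ.ι := by
    ext j
    apply B'.χ.injective
    rw [φ.χ_comp, ψ.χ_comp]
  cases φ; cases ψ
  cases hι
  rfl

/-- **Proposition 4.8 (ii)**, existence half: between two `𝒟`-Θ-bridges there IS an isomorphism (index sets
matched through the labels; the full poly-isomorphism `†𝒟_> ⥲ ‡𝒟_>`), so "the set of isomorphisms between two
`𝒟`-Θ-bridges is of cardinality one". [claim: Mochizuki2012, status: disputed] -/
theorem DThetaBridge.Hom.nonempty (B B' : 𝔡.DThetaBridge) : Nonempty (DThetaBridge.Hom 𝔡 B B') := by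
  refine ⟨⟨B.χ.trans B'.χ.symm, fun j v => ?_⟩⟩
  have hχ : B'.χ ((B.χ.trans B'.χ.symm) j) = B.χ j := by simp
  ext g
  simp only [Set.mem_setOf_eq]
  rw [B.χ_spec, B'.χ_spec, hχ]
  constructor
  · rintro ⟨f, hf, γ, rfl⟩
    obtain ⟨κ⟩ := 𝔡.nonempty_iso v (B.capsule j v) (B'.capsule ((B.χ.trans B'.χ.symm) j) v)
    refine ⟨κ, κ.inv ≫ f ≫ γ.hom, ?_, by rw [Iso.hom_inv_id_assoc]⟩
    exact phiThetaAt_isoComp _ κ.symm (phiThetaAt_compIso _ γ hf)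
  · rintro ⟨κ, f, hf, rfl⟩
    obtain ⟨γ⟩ := 𝔡.nonempty_iso v (B.cod v) (B'.cod v)
    refine ⟨κ.hom ≫ f ≫ γ.inv, ?_, γ, by rw [Category.assoc, Category.assoc, Iso.inv_hom_id, Category.comp_id]⟩
    exact phiThetaAt_isoComp _ κ (phiThetaAt_compIso _ γ.symm hf)

/-! ### Propositions 4.7 (ii)–(iii), 4.8 (i),(iii),(iv), 4.9 as statements -/

/-- The identification of Prop. 4.2 between the label classes at `v` of two `𝒟`-prime-strips (e.g. `†𝒟_j` and
`†𝒟_>`): the pointed `F_l^⋇`-torsor bijection `η ↦ η`. [claim: Mochizuki2012, status: disputed] -/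
noncomputable def DPrimeStrip.labCanon (X Y : 𝔡.DPrimeStrip) (v : 𝔡.V) :
    𝔡.LabCusp v (X v) ≃ 𝔡.LabCusp v (Y v) :=
  (𝔡.isTorsor_labCusp v (X v)).pointedEquiv (𝔡.isTorsor_labCusp v (Y v)) (𝔡.η v (X v)) (𝔡.η v (Y v))

/-- **Proposition 4.7 (ii)** ([IUTchI] p. 112), for a `𝒟`-ΘNF-Hodge theater: "for each `j ∈ J`, restriction at
the various `v ∈ 𝕍` via the portion of `†φ^NF_⋆`, `†φ^Θ_⋆` indexed by `j` determines an isomorphism of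
`F_l^⋇`-torsors `†φ^LC_j : LabCusp(†𝒟^⊚) ⥲ LabCusp(†𝒟_>)` such that `†φ^LC_j` is obtained from `†φ^LC_1` by
composing with the action by `†χ(j)`": (a) all constituents of `†φ^NF_{j,v}` induce the same pull-back of label
classes; (b) identifying `LabCusp(†𝒟_{j,v})` with `LabCusp(†𝒟_{1,v})` as in Prop. 4.2, the pull-back along
`†φ^NF_j` is the pull-back along `†φ^NF_1` precomposed with translation by `†χ(j)` (here `1 ∈ J` is the index
of label `1`). The model case is PROVED (`labPull_of_mem_phiNFj`). [claim: Mochizuki2012, status: disputed] -/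
def Prop47ii (H : 𝔡.DThetaNFHodgeTheater) : Prop :=
  (∀ (j : H.J) (v : 𝔡.V) (f f' : 𝔡.HomNF v (H.capsule j v) H.glob),
      f ∈ H.polyNF j v → f' ∈ H.polyNF j v → 𝔡.labPull f = 𝔡.labPull f') ∧
    ∀ (j j₁ : H.J), H.toDThetaBridge.χ j₁ = 1 → ∀ (v : 𝔡.V) (f : 𝔡.HomNF v (H.capsule j v) H.glob)
      (f₁ : 𝔡.HomNF v (H.capsule j₁ v) H.glob), f ∈ H.polyNF j v → f₁ ∈ H.polyNF j₁ v →
      ∀ c : 𝔡.LabCuspG H.glob,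
        DPrimeStrip.labCanon (H.capsule j) (H.capsule j₁) v (𝔡.labPull f c) =
          𝔡.labPull f₁ (H.toDThetaBridge.χ j • c)

/-- **Proposition 4.7 (iii)** ([IUTchI] p. 112–113): "there exists a unique element `[†ε] ∈ LabCusp(†𝒟^⊚)` such
that for each `j ∈ J` the natural bijection `LabCusp(†𝒟_>) ⥲ F_l^⋇` [of Prop. 4.2] maps `†φ^LC_j([†ε]) ↦ †χ(j)`"
— phrased through pull-backs: a unique global class whose pull-back along every constituent of every
`†φ^NF_{j,v}` has label `†χ(j)`; "`[†ε]` determines an isomorphism of `F_l^⋇`-torsors `†ζ_⋆ : LabCusp(†𝒟^⊚) ⥲ J`"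
(`c = g · [†ε] ↦ †χ⁻¹(g)`). The model case is PROVED (`labEquiv_phiLC_εLab`, `εLab_unique`).
[claim: Mochizuki2012, status: disputed] -/
def Prop47iii (H : 𝔡.DThetaNFHodgeTheater) : Prop :=
  ∃! e : 𝔡.LabCuspG H.glob, ∀ (j : H.J) (v : 𝔡.V) (f : 𝔡.HomNF v (H.capsule j v) H.glob),
    f ∈ H.polyNF j v →
      (𝔡.isTorsor_labCusp v (H.capsule j v)).labelEquiv (𝔡.η v (H.capsule j v)) (𝔡.labPull f e) =
        H.toDThetaBridge.χ j

/-- Prop. 4.7 (iii), last sentence: "when considered up to composition with multiplication by an element of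
`F_l^⋇`, the bijection `†ζ_⋆` is independent of the choice of `†φ^NF_⋆` within the `F_l^⋇`-orbit of `†φ^NF_⋆`
relative to the natural poly-action of `F_l^⋇` on `†𝒟^⊚`": replacing `†φ^NF_⋆` by its post-composite with the
poly-action of `g` replaces the distinguished class `[†ε] = e` by PRECISELY `g⁻¹ · e` (sharp form; L5-lead ruling
2026-08-25T19:22Z after L5-t8's observation that the bare "`∃ t, e' = t · e`" is content-free on a torsor).
[claim: Mochizuki2012, status: disputed] -/
def Prop47iii_orbit (H : 𝔡.DThetaNFHodgeTheater) : Prop :=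
  ∀ (g : FlStar 𝔡.l) (e e' : 𝔡.LabCuspG H.glob),
    (∀ (j : H.J) (v : 𝔡.V) (f : 𝔡.HomNF v (H.capsule j v) H.glob), f ∈ H.polyNF j v →
      (𝔡.isTorsor_labCusp v (H.capsule j v)).labelEquiv (𝔡.η v (H.capsule j v)) (𝔡.labPull f e) =
        H.toDThetaBridge.χ j) →
    (∀ (j : H.J) (v : 𝔡.V) (f : 𝔡.HomNF v (H.capsule j v) H.glob),
      f ∈ (H.polyNF j v).post (𝔡.polyAct H.glob g) →
      (𝔡.isTorsor_labCusp v (H.capsule j v)).labelEquiv (𝔡.η v (H.capsule j v)) (𝔡.labPull f e') =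
        H.toDThetaBridge.χ j) →
    e' = g⁻¹ • e

/-- **Proposition 4.8 (i)** ([IUTchI] p. 115): "the set of isomorphisms between two `𝒟`-NF-bridges forms an
`F_l^⋇`-torsor": it is nonempty, an isomorphism is determined by its bijection of index sets, and exactly `l^⋇`
bijections occur (one orbit under the `F_l^⋇`-translations of Prop. 4.9 (i)). [claim: Mochizuki2012, status: disputed] -/
def Prop48i (B B' : 𝔡.DNFBridge) : Prop :=
  Nonempty (DNFBridge.Hom 𝔡 B B') ∧
    (∀ φ ψ : DNFBridge.Hom 𝔡 B B', φ.ι = ψ.ι → φ = ψ) ∧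
    Nat.card {ι : B.J ≃ B'.J // ∃ φ : DNFBridge.Hom 𝔡 B B', φ.ι = ι} = lStar 𝔡.l

/-- **Proposition 4.8 (ii)**, Hodge-theater half ([IUTchI] p. 115): "the set of isomorphisms between two
`𝒟`-ΘNF-Hodge theaters is of cardinality one". [claim: Mochizuki2012, status: disputed] -/
def Prop48iiHT (H H' : 𝔡.DThetaNFHodgeTheater) : Prop :=
  Nonempty (DThetaNFHodgeTheater.Hom H H') ∧ Subsingleton (DThetaNFHodgeTheater.Hom H H')

/-- **Proposition 4.8 (iii)** ([IUTchI] p. 115): "given a `𝒟`-NF-bridge and a `𝒟`-Θ-bridge, the set of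
capsule-full poly-isomorphisms between the respective capsules of `𝒟`-prime-strips which allow one to glue the
given `𝒟`-NF- and `𝒟`-Θ-bridges together to form a `𝒟`-ΘNF-Hodge theater forms an `F_l^⋇`-torsor": the gluing
bijections `J_NF ≃ J_Θ` — those matching some model indexing of the NF-bridge with the labels `χ` of the
Θ-bridge up to a translation — number exactly `l^⋇`. [claim: Mochizuki2012, status: disputed] -/
def Prop48iii (B : 𝔡.DNFBridge) (T : 𝔡.DThetaBridge) : Prop :=
  Nat.card {g : B.J ≃ T.J // ∃ (ι : FlStar 𝔡.l ≃ B.J) (κ : ∀ j, 𝔡.tautStrip ≅ B.capsule (ι j))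
      (δ : 𝔡.DG ≅ B.glob), (∀ j v, B.poly (ι j) v = PolyHomNF.conj 𝔡 (Pi.isoApp (κ j) v) δ (𝔡.phiNFj j v)) ∧
      ∃ t : FlStar 𝔡.l, ∀ j, T.χ (g (ι j)) = t * j} = lStar 𝔡.l

/-- **Proposition 4.8 (iv)** ([IUTchI] p. 115): "given a `𝒟`-NF-bridge, there exists a [relatively simple]
functorial algorithm for constructing, up to an `F_l^⋇`-indeterminacy, from the given `𝒟`-NF-bridge a
`𝒟`-ΘNF-Hodge theater whose underlying `𝒟`-NF-bridge is the given `𝒟`-NF-bridge" — existence part.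
[claim: Mochizuki2012, status: disputed] -/
def Prop48iv (B : 𝔡.DNFBridge) : Prop := ∃ H : 𝔡.DThetaNFHodgeTheater, H.toDNFBridge = B

/-- Prop. 4.9 (i): the `F_l^⋇`-action on the index set `J` of a `𝒟`-Θ-bridge (hence of a `𝒟`-ΘNF-Hodge
theater, via `toDThetaBridge`), transported from `F_l^⋇ ↷ F_l^⋇` through `†χ`. [claim: Mochizuki2012, status: disputed] -/
noncomputable instance DThetaBridge.labelAction (B : 𝔡.DThetaBridge) : MulAction (FlStar 𝔡.l) B.J where
  smul g j := B.χ.symm (g * B.χ j)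
  one_smul j := by
    change B.χ.symm (1 * B.χ j) = j
    rw [one_mul, Equiv.symm_apply_apply]
  mul_smul g g' j := by
    change B.χ.symm (g * g' * B.χ j) = B.χ.symm (g * B.χ (B.χ.symm (g' * B.χ j)))
    rw [Equiv.apply_symm_apply, mul_assoc]

/-- **Proposition 4.9 (i)** ([IUTchI] p. 115): the output of `†ℋ𝒯^{𝒟-ΘNF} ↦ (†𝒟^⊚ ⟵ †𝒟_J)` "admits an
`F_l^⋇`-symmetry which acts simply transitively on the index set [i.e., `J`] of the underlying capsule of
`𝒟`-prime-strips" (apply to `H.toDThetaBridge`). [claim: Mochizuki2012, status: disputed] -/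
theorem Prop49i (B : 𝔡.DThetaBridge) : IsTorsor (FlStar 𝔡.l) B.J := by
  refine ⟨fun s t => ⟨B.χ t * (B.χ s)⁻¹, ?_, fun g hg => ?_⟩⟩
  · change B.χ.symm (_ * _) = t
    rw [inv_mul_cancel_right, Equiv.symm_apply_apply]
  · change B.χ.symm (g * _) = t at hg
    rw [Equiv.symm_apply_eq] at hg
    rw [← hg, mul_inv_cancel_right]

/-- **Proposition 4.9 (ii)** ([IUTchI] p. 115–116): forgetting everything but the `l^⋇`-capsule `†𝒟_J`, "whose
output data admits an `𝔖_{l^⋇}`-symmetry which acts transitively on the index set `J`".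
[claim: Mochizuki2012, status: disputed] -/
theorem Prop49ii (H : 𝔡.DThetaNFHodgeTheater) (j j' : H.J) : ∃ σ : Equiv.Perm H.J, σ j = j' := by
  classical exact ⟨Equiv.swap j j', Equiv.swap_apply_left j j'⟩

/-- **Proposition 4.9 (iii)** ([IUTchI] p. 116): the `l^⋇`-capsule of `𝒟^⊢`-prime-strips `†𝒟^⊢_J` obtained by
mono-analyticisation (Def. 4.1 (iv)) "satisfies the same symmetry properties with respect to labels" — the
forgetful operation `†ℋ𝒯^{𝒟-ΘNF} ↦ †𝒟^⊢_J`. [claim: Mochizuki2012, status: disputed] -/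
def DThetaNFHodgeTheater.toMonoCapsule (H : 𝔡.DThetaNFHodgeTheater) : H.J → 𝔡.DMonoPrimeStrip :=
  fun j => (H.capsule j).mono

/-- Under the standing assumptions `l` is odd (Def. 3.1 (c): `l ≥ 5`). [claim: Mochizuki2012, status: disputed] -/
theorem l_ne_two (𝔡 : BaseThetaDatum.{u}) : 𝔡.l ≠ 2 := by have := 𝔡.five_le_l; omega

/-- Prop. 4.9 (ii)/(iii): the index set `J` has `l^⋇` elements. [claim: Mochizuki2012, status: disputed] -/
theorem DThetaNFHodgeTheater.card_J (H : 𝔡.DThetaNFHodgeTheater) : Nat.card H.J = lStar 𝔡.l :=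
  (Nat.card_congr H.toDThetaBridge.χ).trans (card_flStar 𝔡.l 𝔡.l_ne_two)

end BaseThetaDatum

end Literature.IUT.HodgeTheaters
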